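import Mathlib
import Summits.NavierStokesRegularity.NavierStokesRegularity.Theorems.PicardRadiiRungThreeRadiiGlueRCore
import Summits.NavierStokesRegularity.NavierStokesRegularity.Theorems.PicardRadiiRungThreeRadiiGlueRFlow
import Summits.NavierStokesRegularity.NavierStokesRegularity.Theorems.PicardRadiiRungThreeRadiiGlueRNK
import HarnessLib

/-!
# `PicardRadiiRungThree.RadiiGlueR` (item stmt-NavierStokesRegularity-23947) — exact window orbits
  from the zeros of the Picard operators, and the TUBE clause

Route `PicardRadiiRungThree` (rung TL-M3 of the Tao ladder; MODEL lattice ODEs only). For the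
normalised Picard operator `G σ z p (t) = p(t) − z − ((1−σ)τs) • ∫₀ᵗ Q(p̃)` of the ω-scaled
window-truncated cascade field on `V = C([0,1], E)`, `E = Fin 4 → ↥[−Kb, Ka] → ℝ`:

* `orbit_of_zero` — a zero `P` of `G σ z` is a Picard path, so the unscaled trajectory
  `y_{i,n}(s) = ω_n fE(P̃(s/((1−σ)τs)))_{i,n}` starts at `ω·fE z`, solves the window-truncated cascade
  ODE within `[0, S]` for every `S ≤ (1−σ)τs`, and stays componentwise within `ω_k ‖P − p‖` of the
  unscaled values of any other path `p`;
* `tube_of_nk` — the TUBE clause of the exact-flow certificate `ExactFlowCertificateR` for the orbit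
  `x` extracted at `σ = 0`: restarting at base parameter `σ = t/τs` from two states `z, z'` that are
  `κ ω`-close to `x(t)` and `d ω`-close to each other, the Newton–Kantorovich clause at `(σ, ẑ)`,
  `(σ, ẑ')` (granted by the certificate's tube hypothesis) yields exact orbits on `[0, u]`,
  `t + u ≤ τq ≤ τs`, under the sup bounds `M` and `Λ d ω`-close (`norm_sub_le_of_nk_shift`).

HONEST FRAMING: bookkeeping about Tao-type MODEL lattice ODEs; nothing here is a statement about the
Navier–Stokes equations; NS regularity is NOT proved by anything in this file.
-/

noncomputable section

-- the sub-problem namespace repeats the summit name by design (D-0017)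
set_option linter.dupNamespace false

namespace Summit.NavierStokesRegularity.NavierStokesRegularity.Theorems

open Set Metric Function MeasureTheory intervalIntegral Literature.Analysis.FluidPDE
  Literature.Analysis.FluidPDE.TaoCascade

namespace RadiiGlueR

variable {Kb Ka : ℤ}

/-- Componentwise differences of window states are bounded by the sup norm. [folklore] -/
theorem abs_apply_sub_apply_le (e e' : Fin 4 → ↥(Finset.Icc (-Kb) Ka) → ℝ) (i : Fin 4)
    (k : ↥(Finset.Icc (-Kb) Ka)) : |e i k - e' i k| ≤ ‖e - e'‖ := by
  have h1 : |e i k - e' i k| = ‖(e - e') i k‖ := by rw [Real.norm_eq_abs]; rfl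
  rw [h1]
  exact (norm_le_pi_norm _ _).trans (norm_le_pi_norm _ _)

/-- The sup norm of a window state is bounded by a bound on all its components (`0 ≤ C`). [folklore] -/
theorem pi_norm_le_of_forall (e : Fin 4 → ↥(Finset.Icc (-Kb) Ka) → ℝ) {C : ℝ} (hC : 0 ≤ C)
    (h : ∀ (i : Fin 4) (k : ↥(Finset.Icc (-Kb) Ka)), |e i k| ≤ C) : ‖e‖ ≤ C := by
  refine (pi_norm_le_iff_of_nonneg hC).mpr fun i => (pi_norm_le_iff_of_nonneg hC).mpr fun k => ?_
  rw [Real.norm_eq_abs]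
  exact h i k

/-- **A zero of the Picard operator satisfies the integral equation** `P(t) = z + ((1−σ)τs) • ∫₀ᵗ Q(P̃)`.
[folklore] -/
theorem intEq_of_zero
    (Q : (Fin 4 → ↥(Finset.Icc (-Kb) Ka) → ℝ) → (Fin 4 → ↥(Finset.Icc (-Kb) Ka) → ℝ))
    (G : ℝ → (Fin 4 → ↥(Finset.Icc (-Kb) Ka) → ℝ) →
      C(↥(Icc (0 : ℝ) 1), Fin 4 → ↥(Finset.Icc (-Kb) Ka) → ℝ) →
      C(↥(Icc (0 : ℝ) 1), Fin 4 → ↥(Finset.Icc (-Kb) Ka) → ℝ)) {τs : ℝ}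
    (hG : ∀ σ z (p : C(↥(Icc (0 : ℝ) 1), Fin 4 → ↥(Finset.Icc (-Kb) Ka) → ℝ)) (t : ↥(Icc (0 : ℝ) 1)),
      (G σ z p) t = p t - z - ((1 - σ) * τs) • ∫ u in (0 : ℝ)..(t : ℝ), Q (IccExtend zero_le_one p u))
    {σ : ℝ} {z : Fin 4 → ↥(Finset.Icc (-Kb) Ka) → ℝ}
    {P : C(↥(Icc (0 : ℝ) 1), Fin 4 → ↥(Finset.Icc (-Kb) Ka) → ℝ)} (hP : G σ z P = 0) :
    ∀ t : ↥(Icc (0 : ℝ) 1), P t = z + ((1 - σ) * τs) •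
      ∫ u in (0 : ℝ)..(t : ℝ), Q (IccExtend zero_le_one P u) := by
  intro t
  have h1 := congrArg (fun f : C(↥(Icc (0 : ℝ) 1), Fin 4 → ↥(Finset.Icc (-Kb) Ka) → ℝ) => f t) hP
  simp only [hG, ContinuousMap.zero_apply] at h1
  rw [sub_sub, sub_eq_zero] at h1
  exact h1

/-- **Exact window orbit from a Picard path.** Let `Q` be the (continuous) ω-scaled truncated field and
`P` a path with `P(t) = z + T • ∫₀ᵗ Q(P̃)` (`T > 0`). Then the unscaled trajectory
`y_{i,n}(s) = ω_n · fE(P̃(s/T))_{i,n}` satisfies `y_{i,n}(0) = ω_n fE(z)_{i,n}`, solves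
`ẏ_{i,k} = quadTerm(y·𝟙_{window})_{i,k}` within `[0, S]` for all window shells `k` and `S ≤ T`, and
`|y_{i,n}(s) − ω_n fE(p̃(s/T))_{i,n}| ≤ ω_n ‖P − p‖` for every path `p`.
[cite: Tao2016AveragedNS, §4 (4.8) (the truncated window system)] -/
theorem orbit_of_intEq (α : Fin 4 → Fin 4 → Fin 4 → ℤ × ℤ × ℤ → ℝ) {ω : ℤ → ℝ} (hω : ∀ k, 0 < ω k)
    (fE : (Fin 4 → ↥(Finset.Icc (-Kb) Ka) → ℝ) → Fin 4 → ℤ → ℝ)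
    (hfE1 : ∀ e i n (h : -Kb ≤ n ∧ n ≤ Ka), fE e i n = e i ⟨n, Finset.mem_Icc.mpr h⟩)
    (hfE0 : ∀ e i n, ¬ (-Kb ≤ n ∧ n ≤ Ka) → fE e i n = 0)
    (Q : (Fin 4 → ↥(Finset.Icc (-Kb) Ka) → ℝ) → (Fin 4 → ↥(Finset.Icc (-Kb) Ka) → ℝ))
    (hQ : ∀ e i (k : ↥(Finset.Icc (-Kb) Ka)),
      Q e i k = quadTerm 1 α (fun j' n (_ : ℝ) => ω n * fE e j' n) i k 0 / ω k)
    (hQc : Continuous Q) {T : ℝ} (hT : 0 < T) {z : Fin 4 → ↥(Finset.Icc (-Kb) Ka) → ℝ}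
    {P : C(↥(Icc (0 : ℝ) 1), Fin 4 → ↥(Finset.Icc (-Kb) Ka) → ℝ)}
    (hint : ∀ t : ↥(Icc (0 : ℝ) 1), P t = z + T • ∫ u in (0 : ℝ)..(t : ℝ), Q (IccExtend zero_le_one P u))
    (y : Fin 4 → ℤ → ℝ → ℝ)
    (hy : ∀ i n s, y i n s = ω n * fE (IccExtend zero_le_one P (s / T)) i n) :
    (∀ i n, y i n 0 = ω n * fE z i n) ∧
    (∀ S, S ≤ T → ∀ i k, -Kb ≤ k → k ≤ Ka → ∀ s ∈ Icc 0 S, HasDerivWithinAt (y i k)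
      (quadTerm 1 α (fun j' n s' => if -Kb ≤ n ∧ n ≤ Ka then y j' n s' else 0) i k s) (Icc 0 S) s) ∧
    (∀ (p : C(↥(Icc (0 : ℝ) 1), Fin 4 → ↥(Finset.Icc (-Kb) Ka) → ℝ)) (i : Fin 4) (n : ℤ) (s : ℝ),
      |y i n s - ω n * fE (IccExtend zero_le_one p (s / T)) i n| ≤ ω n * ‖P - p‖) := by
  have hderiv := picardPath_hasDerivWithinAt hQc hint
  have h0 := picardPath_zero hint
  refine ⟨fun i n => flow_zero fE h0 y hy i n, fun S hS => ?_, fun p i n s => ?_⟩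
  · exact flow_hasDerivWithinAt α hω fE hfE1 hfE0 Q hQ hT hderiv y hy hS
  · rw [hy i n s, ← mul_sub, abs_mul, abs_of_pos (hω n)]
    refine mul_le_mul_of_nonneg_left ?_ (hω n).le
    exact (abs_fE_sub_fE_le fE hfE1 hfE0 _ _ i n).trans (norm_IccExtend_sub_le P p _)

/-- **The TUBE clause from the Newton–Kantorovich restarts** (see the module docstring).
[cite: Tao2016AveragedNS, §4 (4.8) (the truncated window system)] -/
theorem tube_of_nk (α : Fin 4 → Fin 4 → Fin 4 → ℤ × ℤ × ℤ → ℝ) {ω : ℤ → ℝ} (hω : ∀ k, 0 < ω k)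
    (fE : (Fin 4 → ↥(Finset.Icc (-Kb) Ka) → ℝ) → Fin 4 → ℤ → ℝ)
    (hfE1 : ∀ e i n (h : -Kb ≤ n ∧ n ≤ Ka), fE e i n = e i ⟨n, Finset.mem_Icc.mpr h⟩)
    (hfE0 : ∀ e i n, ¬ (-Kb ≤ n ∧ n ≤ Ka) → fE e i n = 0)
    (Q : (Fin 4 → ↥(Finset.Icc (-Kb) Ka) → ℝ) → (Fin 4 → ↥(Finset.Icc (-Kb) Ka) → ℝ))
    (hQ : ∀ e i (k : ↥(Finset.Icc (-Kb) Ka)),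
      Q e i k = quadTerm 1 α (fun j' n (_ : ℝ) => ω n * fE e j' n) i k 0 / ω k)
    (hQc : Continuous Q)
    (xb : ℝ → (Fin 4 → ↥(Finset.Icc (-Kb) Ka) → ℝ) →
      C(↥(Icc (0 : ℝ) 1), Fin 4 → ↥(Finset.Icc (-Kb) Ka) → ℝ))
    (G : ℝ → (Fin 4 → ↥(Finset.Icc (-Kb) Ka) → ℝ) →
      C(↥(Icc (0 : ℝ) 1), Fin 4 → ↥(Finset.Icc (-Kb) Ka) → ℝ) →
      C(↥(Icc (0 : ℝ) 1), Fin 4 → ↥(Finset.Icc (-Kb) Ka) → ℝ))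
    (G' : ℝ → C(↥(Icc (0 : ℝ) 1), Fin 4 → ↥(Finset.Icc (-Kb) Ka) → ℝ) →
      (C(↥(Icc (0 : ℝ) 1), Fin 4 → ↥(Finset.Icc (-Kb) Ka) → ℝ) →L[ℝ]
        C(↥(Icc (0 : ℝ) 1), Fin 4 → ↥(Finset.Icc (-Kb) Ka) → ℝ)))
    (A : ℝ → (Fin 4 → ↥(Finset.Icc (-Kb) Ka) → ℝ) →
      (C(↥(Icc (0 : ℝ) 1), Fin 4 → ↥(Finset.Icc (-Kb) Ka) → ℝ) →L[ℝ]
        C(↥(Icc (0 : ℝ) 1), Fin 4 → ↥(Finset.Icc (-Kb) Ka) → ℝ)))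
    {τs Y₀ Z Λ r₁ r₂ κ : ℝ} {M : ℤ → ℝ}
    (hG : ∀ σ z (p : C(↥(Icc (0 : ℝ) 1), Fin 4 → ↥(Finset.Icc (-Kb) Ka) → ℝ)) (t : ↥(Icc (0 : ℝ) 1)),
      (G σ z p) t = p t - z - ((1 - σ) * τs) • ∫ u in (0 : ℝ)..(t : ℝ), Q (IccExtend zero_le_one p u))
    (NK : ℝ → (Fin 4 → ↥(Finset.Icc (-Kb) Ka) → ℝ) → Prop)
    (hNK : ∀ σ z, NK σ z → Injective (A σ z) ∧ ‖A σ z (G σ z (xb σ z))‖ ≤ Y₀ ∧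
      ‖A σ z‖ ≤ Λ * (1 - Z) ∧
      (∀ x, ‖x - xb σ z‖ ≤ r₂ → HasFDerivAt (G σ z) (G' σ x) x ∧
        ‖ContinuousLinearMap.id ℝ _ - (A σ z).comp (G' σ x)‖ ≤ Z) ∧
      ∀ (t : ℝ) (i : Fin 4) (k : ℤ), -Kb ≤ k → k ≤ Ka →
        ω k * (|fE (IccExtend zero_le_one (xb σ z) t) i k| + r₂) ≤ M k)
    (hτs : 0 < τs) (hr : r₁ ≤ r₂) (hZ1 : Z < 1) (hp : Y₀ + Z * r₁ ≤ r₁) (hκ : 0 ≤ κ)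
    (hKa : 1 ≤ Ka) (hKb : 0 ≤ Kb)
    {zq : Fin 4 → ↥(Finset.Icc (-Kb) Ka) → ℝ}
    {P : C(↥(Icc (0 : ℝ) 1), Fin 4 → ↥(Finset.Icc (-Kb) Ka) → ℝ)} (hPr : ‖P - xb 0 zq‖ ≤ r₁)
    (x : Fin 4 → ℤ → ℝ → ℝ) (hx : ∀ i n s, x i n s = ω n * fE (IccExtend zero_le_one P (s / τs)) i n)
    (htube : ∀ σ ∈ Icc (0 : ℝ) 1, ∀ z z' : Fin 4 → ↥(Finset.Icc (-Kb) Ka) → ℝ,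
      ‖z - IccExtend zero_le_one (xb 0 zq) σ‖ ≤ κ + r₁ →
      ‖z' - IccExtend zero_le_one (xb 0 zq) σ‖ ≤ κ + r₁ → NK σ z ∧ ‖xb σ z - xb σ z'‖ + r₁ ≤ r₂)
    {τq : ℝ} (hτq : τq ≤ τs) :
    ∀ t ∈ Icc 0 τq, ∀ (z z' : Fin 4 → ℤ → ℝ) (d u : ℝ),
      (∀ i k, -Kb ≤ k → k ≤ Ka →
        |z i k - x i k t| ≤ κ * ω k ∧ |z' i k - x i k t| ≤ κ * ω k ∧ |z i k - z' i k| ≤ d * ω k) →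
      0 < u → t + u ≤ τq →
      ∃ y y' : Fin 4 → ℤ → ℝ → ℝ, ∀ i k, -Kb ≤ k → k ≤ Ka → y i k 0 = z i k ∧ y' i k 0 = z' i k ∧
        ∀ t' ∈ Icc 0 u,
          HasDerivWithinAt (y i k)
            (quadTerm 1 α (fun j' n s' => if -Kb ≤ n ∧ n ≤ Ka then y j' n s' else 0) i k t')
            (Icc 0 u) t' ∧
          HasDerivWithinAt (y' i k)
            (quadTerm 1 α (fun j' n s' => if -Kb ≤ n ∧ n ≤ Ka then y' j' n s' else 0) i k t')
            (Icc 0 u) t' ∧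
          |y i k t'| ≤ M k ∧ |y' i k t'| ≤ M k ∧ |y i k t' - y' i k t'| ≤ Λ * d * ω k := by
  intro t ht z z' d u hclose hu htu
  -- the restart parameter and horizon
  set σ : ℝ := t / τs with hσ
  have ht0 : 0 ≤ t := ht.1
  have htτ : t < τs := by linarith [ht.2]
  have hσI : σ ∈ Icc (0 : ℝ) 1 := ⟨div_nonneg ht0 hτs.le, (div_le_one hτs).mpr (by linarith)⟩
  have hTeq : (1 - σ) * τs = τs - t := by rw [hσ]; field_simp
  have hT : 0 < (1 - σ) * τs := by rw [hTeq]; linarith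
  have huT : u ≤ (1 - σ) * τs := by rw [hTeq]; linarith
  -- scaled restart states
  set Zs : Fin 4 → ↥(Finset.Icc (-Kb) Ka) → ℝ := fun i k => z i k / ω k with hZs
  set Zs' : Fin 4 → ↥(Finset.Icc (-Kb) Ka) → ℝ := fun i k => z' i k / ω k with hZs'
  have hmemk : ∀ k : ↥(Finset.Icc (-Kb) Ka), -Kb ≤ (k : ℤ) ∧ (k : ℤ) ≤ Ka := fun k =>
    Finset.mem_Icc.mp k.2
  -- the base orbit at parameter σ is within r₁ of the approximate orbit
  have hxσ : ∀ (i : Fin 4) (k : ↥(Finset.Icc (-Kb) Ka)),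
      x i k t / ω k = (IccExtend zero_le_one P σ) i k := by
    intro i k
    have h1 : fE (IccExtend zero_le_one P σ) i k = (IccExtend zero_le_one P σ) i k :=
      hfE1 _ i k (hmemk k)
    rw [hx i k t, ← hσ, h1]
    field_simp [(hω k).ne']
  have hclose' : ∀ w : Fin 4 → ℤ → ℝ, (∀ i k, -Kb ≤ k → k ≤ Ka → |w i k - x i k t| ≤ κ * ω k) →
      ‖(fun i (k : ↥(Finset.Icc (-Kb) Ka)) => w i k / ω k) - IccExtend zero_le_one (xb 0 zq) σ‖ ≤ κ + r₁ := by
    intro w hw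
    have hr₁0 : 0 ≤ r₁ := le_trans (norm_nonneg _) hPr
    refine pi_norm_le_of_forall _ (by positivity) fun i k => ?_
    have h1 : |w i k / ω k - x i k t / ω k| ≤ κ := by
      rw [← sub_div, abs_div, abs_of_pos (hω k), div_le_iff₀ (hω k)]
      exact hw i k (hmemk k).1 (hmemk k).2
    have h2 : |(IccExtend zero_le_one P σ) i k - (IccExtend zero_le_one (xb 0 zq) σ) i k| ≤ r₁ :=
      (abs_apply_sub_apply_le _ _ i k).trans ((norm_IccExtend_sub_le P (xb 0 zq) σ).trans hPr)
    have h3 : |w i k / ω k - (IccExtend zero_le_one (xb 0 zq) σ) i k| ≤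
        |w i k / ω k - x i k t / ω k| +
          |(IccExtend zero_le_one P σ) i k - (IccExtend zero_le_one (xb 0 zq) σ) i k| := by
      rw [← hxσ i k]; exact abs_sub_le _ _ _
    simpa using h3.trans (add_le_add h1 h2)
  have hZs_close := hclose' z fun i k h1 h2 => (hclose i k h1 h2).1
  have hZs'_close := hclose' z' fun i k h1 h2 => (hclose i k h1 h2).2.1
  obtain ⟨hNKz, hcoh⟩ := htube σ hσI Zs Zs' hZs_close hZs'_close
  have hNKz' := (htube σ hσI Zs' Zs' hZs'_close hZs'_close).1
  obtain ⟨hAz, hYz, hAΛz, hballz, hMz⟩ := hNK σ Zs hNKz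
  obtain ⟨hAz', hYz', -, hballz', hMz'⟩ := hNK σ Zs' hNKz'
  -- the two zeros
  obtain ⟨Pz, hPz0, hPzr⟩ := exists_zero_of_nk hAz hYz hballz hr hZ1 hp
  obtain ⟨Pz', hPz'0, hPz'r⟩ := exists_zero_of_nk hAz' hYz' hballz' hr hZ1 hp
  -- their distance
  have hd0 : 0 ≤ d := by
    have h1 := (hclose 0 1 (by linarith) hKa).2.2
    have := abs_nonneg (z 0 1 - z' 0 1)
    nlinarith [hω 1]
  have hΛ0 : 0 ≤ Λ := by
    have h1 : 0 ≤ Λ * (1 - Z) := le_trans (norm_nonneg (A σ Zs)) hAΛz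
    nlinarith
  have hv : ∀ p, G σ Zs' p = G σ Zs p + ContinuousMap.const _ (Zs - Zs') := by
    intro p; ext t' i k
    simp only [hG, ContinuousMap.add_apply, ContinuousMap.const_apply, Pi.add_apply, Pi.sub_apply]
    ring
  have hdist : ‖Pz - Pz'‖ ≤ Λ * ‖ContinuousMap.const (↥(Icc (0 : ℝ) 1)) (Zs - Zs')‖ :=
    norm_sub_le_of_nk_shift hv hballz hZ1 hAΛz hPz0 hPz'0 hPzr hPz'r hcoh
  have hconst : ‖ContinuousMap.const (↥(Icc (0 : ℝ) 1)) (Zs - Zs')‖ ≤ d := by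
    refine (ContinuousMap.norm_le _ hd0).mpr fun t' => ?_
    rw [ContinuousMap.const_apply]
    refine pi_norm_le_of_forall _ hd0 fun i k => ?_
    have h1 := (hclose i k (hmemk k).1 (hmemk k).2).2.2
    simp only [hZs, hZs', Pi.sub_apply]
    rw [← sub_div, abs_div, abs_of_pos (hω k), div_le_iff₀ (hω k)]
    exact h1
  have hPP : ‖Pz - Pz'‖ ≤ Λ * d := hdist.trans (mul_le_mul_of_nonneg_left hconst hΛ0)
  -- the two restarted orbits
  set y : Fin 4 → ℤ → ℝ → ℝ := fun i n s' =>
    ω n * fE (IccExtend zero_le_one Pz (s' / ((1 - σ) * τs))) i n with hy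
  set y' : Fin 4 → ℤ → ℝ → ℝ := fun i n s' =>
    ω n * fE (IccExtend zero_le_one Pz' (s' / ((1 - σ) * τs))) i n with hy'
  have hOy := orbit_of_intEq α hω fE hfE1 hfE0 Q hQ hQc hT (intEq_of_zero Q G hG hPz0) y
    (fun i n s' => rfl)
  have hOy' := orbit_of_intEq α hω fE hfE1 hfE0 Q hQ hQc hT (intEq_of_zero Q G hG hPz'0) y'
    (fun i n s' => rfl)
  refine ⟨y, y', fun i k hk1 hk2 => ⟨?_, ?_, fun t' ht' => ⟨?_, ?_, ?_, ?_, ?_⟩⟩⟩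
  · rw [hOy.1 i k, hfE1 _ i k ⟨hk1, hk2⟩]
    simp only [hZs]
    field_simp [(hω k).ne']
  · rw [hOy'.1 i k, hfE1 _ i k ⟨hk1, hk2⟩]
    simp only [hZs']
    field_simp [(hω k).ne']
  · exact hOy.2.1 u huT i k hk1 hk2 t' ht'
  · exact hOy'.2.1 u huT i k hk1 hk2 t' ht'
  · have h1 := hOy.2.2 (xb σ Zs) i k t'
    have h2 := hMz (t' / ((1 - σ) * τs)) i k hk1 hk2
    have h3 : ω k * ‖Pz - xb σ Zs‖ ≤ ω k * r₂ := mul_le_mul_of_nonneg_left (hPzr.trans hr) (hω k).le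
    have h4 := abs_sub_abs_le_abs_sub (y i k t')
      (ω k * fE (IccExtend zero_le_one (xb σ Zs) (t' / ((1 - σ) * τs))) i k)
    have h5 : |ω k * fE (IccExtend zero_le_one (xb σ Zs) (t' / ((1 - σ) * τs))) i k| =
        ω k * |fE (IccExtend zero_le_one (xb σ Zs) (t' / ((1 - σ) * τs))) i k| := by
      rw [abs_mul, abs_of_pos (hω k)]
    linarith
  · have h1 := hOy'.2.2 (xb σ Zs') i k t'
    have h2 := hMz' (t' / ((1 - σ) * τs)) i k hk1 hk2
    have h3 : ω k * ‖Pz' - xb σ Zs'‖ ≤ ω k * r₂ := mul_le_mul_of_nonneg_left (hPz'r.trans hr) (hω k).le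
    have h4 := abs_sub_abs_le_abs_sub (y' i k t')
      (ω k * fE (IccExtend zero_le_one (xb σ Zs') (t' / ((1 - σ) * τs))) i k)
    have h5 : |ω k * fE (IccExtend zero_le_one (xb σ Zs') (t' / ((1 - σ) * τs))) i k| =
        ω k * |fE (IccExtend zero_le_one (xb σ Zs') (t' / ((1 - σ) * τs))) i k| := by
      rw [abs_mul, abs_of_pos (hω k)]
    linarith
  · have h1 := hOy.2.2 Pz' i k t'
    have h2 : ω k * ‖Pz - Pz'‖ ≤ ω k * (Λ * d) := mul_le_mul_of_nonneg_left hPP (hω k).le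
    have e1 : y' i k t' = ω k * fE (IccExtend zero_le_one Pz' (t' / ((1 - σ) * τs))) i k := rfl
    rw [e1]
    linarith

end RadiiGlueR

end Summit.NavierStokesRegularity.NavierStokesRegularity.Theorems

end
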